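import Summits.CriticalPhenomena.PercolationContinuityZ3.Theorems.PercNearOneGluingNoHeavyQuantDepthOneRows
import Summits.CriticalPhenomena.PercolationContinuityZ3.Theorems.PercNearOneGluingNoHeavyQuantTLBClosure
import HarnessLib

/-!
# QUANT lane R8, the GRADED-CLOSURE programme for the light half (lead g37 RULING V364), part 2: the typed node G₀
# `LawDec.TLCGateConvTLB` — depth ≤ 1 factors (`TLB ∧ TLC`) ⟹ depth 0 product (`TLB`) under one gate — and its bridges

builds on p205010 (kernel theorem, internal audit signed; external expert review pending)

Statement + support file (`--supports stmt-CriticalPhenomena-4575`), QUANT lane seat prim-quant-census-2 (gen 64), rung R8 of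
`run/shared/lean/prim/quant/LADDER.md`; lane INBOX 2026-08-24 l.1366 (RULING V364).  One `@[conjecture]` (`LawDec.TLCGateConvTLB` = G₀), theorems
with standard axioms, no sorries.  Part 1 is `…QuantDepthOneRows` (`LawDec.TLC`, `tlc_of_decAt_all`, `twoLayerRow_of_tlc`); this part adds the
two-layer vocabulary of record (`LawDec.TLB`, `…QuantTLBClosure`, lead g37).  Census memo: `run/shared/lean/prim/quant/prim-quant-census-2-g64/G0-CENSUS-G64.md`.

THE NODE G₀ (lead g37 V364, "depth ≤ 1 factors ⟹ depth 0 product"): in the binder of `LawDec.TLBGateConvClosed` (the depth-0 single-gate closure,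
REFUTED: `not_tlbGateConvClosed`, witness at `M = 12`, family from `M = 9`) ADD the hypothesis `LawDec.TLC y (q·Tᵢ) Mᵢ (gate μᵢ q)` (all
top-low-capacity rows) on both gated factors; conclude `LawDec.TLB` for the gated convolution.  One extra depth in the hypothesis buys the product's
rows one depth lower — while every SAME-depth closure of the light half is false: depth 0 at `M = 9` (lead g37 / census-2 g63), gate-stable depth 0
at `M = 11`, and depth 1 (TLC ⟹ TLC) not only at the lead's `M = 15` / `1.5·10⁻⁵` but ROBUSTLY: census-2 g64 kit j214626 finds 118 exact witnesses
at `M ≥ 14` for floors `y ∈ [0.23, 0.47]`, up to `1/448` — e.g. `q = 1`, `y = 1/4`, `μ₁ = {0: ½, 1: ½}`, `μ₂ = {1: 9/16, 2: 3/16, 4: 15/224, 18: 41/224}`,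
product row TLCR(7, 2) short by `1/448`.  G₀ is NOT implied by `LawDec.SingleGateConvClosed` (it quantifies over factors that are not DEC) and does
not imply it; it is the first, finitely-typed member of the programme `G_k` (depth ≤ k+1 ⟹ depth ≤ k) whose conjunction over `k` gives the
single-gate closure; restricted to DEC factors it is census-2 g63's `gateConv_deepLows` (`tlb_gateConv_of_decAt_all` below).

* `LawDec.tlb_of_tlc` — `TLC` contains depth 0, in the `TLB` vocabulary (part 1's `twoLayerRow_of_tlc`): the `TLB` hypotheses of G₀ are redundant.
* `LawDec.tlb_gate_of_decAt_all` — in the binder of `SingleGateConvClosed` each gated factor satisfies `TLB` (and `TLC`, part 1).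
* **`LawDec.TLCGateConvTLB`** (`@[conjecture]`, G₀).
* `LawDec.tlb_gateConv_of_decAt_all` — G₀ ⟹ the gated convolution of two laws that are DEC at all layers satisfies every two-layer bound.

EVIDENCE for `TLCGateConvTLB` (census-2 g64; all EXACT: float HiGHS proposes a vertex, rational arithmetic certifies the primal vertex, its feasibility
and the dual signs, exact two-phase simplex as fallback; the engine reproduces the depth-0 witness `9163/8100000` and the depth-1 witness `1.5058·10⁻⁵`
to the digit; kit jobs attached to item stmt-CriticalPhenomena-4575).  TARGETED scans — free factor on the FULL support `{0..M₁}` over the exact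
depth-1 polytope {mass, mean, TLB, TLC}, admissible small partners (relay, blobs `{0,m}`, `δ₁ δ₂ δ₃`, relay∗relay, relay∗blob; top-affordability-tight
and interior means), 7 means of the free factor, EVERY product two-layer row: light grid (16 `(q, y)` with `y < q/2`, `q ∈ {1, .95, .9, .75, .5}`)
`M₁ ≤ 34` (j214516 / j214517: 35 728 cells, 198 456 LPs); near-half grid `M₁ ≤ 40` (j214519: 10 290 / 77 407) and `41 ≤ M₁ ≤ 72` (j214651: 8 064 /
136 160); heavy grid `M₁ ≤ 24` (j214520: 14 630 / 93 257); low floors `y ≤ 3/20`, `q ∈ {1, .6, .4, .3, .2, .1}`, `M₁ ≤ 60` (j214649: 46 585 / 196 942);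
dense `y ∈ {.30, .31, …, .49}` `M₁ ≤ 30` with tight partners (j214652: 26 250 / 143 922) and with 17 interior-mean partners (j215152: 80 325 / 430 376):
**221 872 cells, 1 276 520 certified LPs, 0 violations, worst margin EXACTLY 0** (E-tight equality cases), maximisers with ≤ 5 atoms.  TWO-FREE-FACTOR
alternating adversary (float alternation, exact certified finish; the same engine finds 118 depth-1-closure witnesses in 198 825 trials): `M₁ ≤ 3`,
`M₂ ≤ 24`, light floors, 397 020 trials (j214623): 0 violations, 107 501 trials end at margin exactly 0.
VERTEX census of the depth-1 polytope on `{0..M}` (j214664 / j214787, `M ≤ 22`, 151 762 vertices): at most 5 atoms (`M ≤ 7`: 3, `M ≤ 11`: 4), the 5-atom vertices being "three lows + one mid + top"; all vertex pairs with `M₁ + M₂ ≤ 16` × all rows: 0 violations (18.9 M tests).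
TENSOR CERTIFICATES (arm-2 g38's pointwise principle `twoLayer_pair_of_certificate` with TLC rows added, j214798 / j214799): on the cells of the
depth-0 counterexamples (relay ⊗ `{0..M₁}`, `M₁ = 8..13`, `y ∈ {.45, .49}`) NO certificate exists from the two-layer rows alone (10 cells, exact), and
one ALWAYS exists once the TLC rows are allowed (80 / 80, exact rationals, support ≤ 4: one or two TLC rows of the big factor + mean tilts);
on 4 995 further cells (partners relay / blob / `δ₁` / `δ₂` ⊗ `M₁ ≤ 16`, symmetric pairs `M₁, M₂ ≤ 8`, seven `(q, y)` incl. heavy; j215110): 4 995 feasible,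
exact, support ≤ 6, 793 of them using TLC rows.
HONEST STATUS: `TLCGateConvTLB` is OPEN (a conjecture with exact evidence); nothing in the lane's RATE class log\* or honest sentence
(`run/shared/lean/prim/quant/README.md`) changes.

[this work]; two-layer bounds / refuted depth-0 node: prim-quant-lead g37 (`…QuantTLBClosure`), prim-quant-arm-2 g34/g38 (`…QuantTwoLayerClosure`,
`…QuantTwoLayerCertificate`); TLCR rows: prim-quant-census-2 g63 (this lane).  Nothing here is cited as a published result.  The gluing rows served
[cite: KozmaNitzan2024, Conjecture 3 (p. 15)]; product measure [cite: Grimmett1999, §1.3 p. 10].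
-/

noncomputable section

namespace Summit.CriticalPhenomena.PercolationContinuityZ3.Theorems

namespace Quant

open Finset

namespace LawDec

/-! ### TLC ⟹ TLB, in the vocabulary of record -/

/-- **`TLC` contains depth 0** (`τ ≤ M`): all top-low-capacity rows imply the two-layer-bound family `TLB (y/(1−y)) τ M ν` — part 1's
`twoLayerRow_of_tlc`, row by row.  So the `TLB` hypotheses of G₀ are implied by its `TLC` hypotheses. [this work] -/
theorem tlb_of_tlc {y τ : ℝ} {M : ℕ} {ν : ℕ → ℝ} (hτM : τ ≤ (M : ℝ)) (h : TLC y τ M ν) :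
    TLB (y / (1 - y)) τ M ν :=
  fun d hd => twoLayerRow_of_tlc hτM h d hd

/-- **in the binder of `LawDec.SingleGateConvClosed` the gated factor satisfies `TLB`** (`0 < y < 1`, `0 ≤ q ≤ 1`, `μ` a probability law on
`{0..M}`, `gate μ q` DEC at every layer `j < M`): through `TLC` (`tlc_gate_of_decAt_all`) and `tlb_of_tlc` (`q·T ≤ M`, `gate_target_le_top`).
[this work] -/
theorem tlb_gate_of_decAt_all {y q : ℝ} {M : ℕ} {μ : ℕ → ℝ} (hy0 : 0 < y) (hy1 : y < 1) (hq0 : 0 ≤ q) (hq1 : q ≤ 1)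
    (hμ0 : ∀ h, 0 ≤ μ h) (hμ1 : ∑ h ∈ Finset.range (M + 1), μ h = 1)
    (hdec : ∀ j, j < M → DECAt y j M (gate μ q)) :
    TLB (y / (1 - y)) (q * ∑ h ∈ Finset.range (M + 1), (h : ℝ) * μ h) M (gate μ q) :=
  tlb_of_tlc (gate_target_le_top hq0 hq1 hμ0 hμ1) (tlc_gate_of_decAt_all hy0 hy1 hdec)

/-! ### The node G₀ -/

/-- **CONJECTURE G₀ (DEPTH ≤ 1 FACTORS ⟹ DEPTH 0 PRODUCT; lead g37 RULING V364, typed by census-2 g64).**  For a floor `0 < y < 1`, one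
gate `0 < q ≤ 1`, probability laws `μ₁` on `{0..M₁}`, `μ₂` on `{0..M₂}` (nonnegative, vanishing above the top, mass `1`) whose gated versions are
top-affordable at `y` (`y·Mᵢ ≤ q·Tᵢ`) and satisfy the two-layer bounds `TLB (y/(1−y)) (q·Tᵢ) Mᵢ (gate μᵢ q)` AND all top-low-capacity rows
`TLC y (q·Tᵢ) Mᵢ (gate μᵢ q)` (the first follow from the second, `tlb_of_tlc`; both follow from DEC at all layers, `tlb_gate_of_decAt_all` /
`tlc_gate_of_decAt_all`), the gated convolution satisfies the two-layer bounds: `TLB (y/(1−y)) (q·(T₁+T₂)) (M₁+M₂) (gate (lconv M₁ M₂ μ₁ μ₂) q)`.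
Without the `TLC` hypotheses this is `TLBGateConvClosed`, FALSE (`not_tlbGateConvClosed`); with `TLC` also in the conclusion it is the depth-1
closure, FALSE at `M = 14` (module docstring).  EVIDENCE (exact, 0 violations in 1.28 M certified LPs on 221 872 cells to `M₁ = 72`, 397 020 two-free-factor adversarial
trials and 18.9 M vertex-pair tests, worst margin exactly 0; tensor certificates exist on all 5 075 tested cells): module docstring; kit j214516 j214517 j214519 j214520 j214649 j214651 j214652 j214664
j214787 j214798 j214799 j215110 j215152 j214623 on item stmt-CriticalPhenomena-4575.
builds on p205010 (kernel theorem, internal audit signed; external expert review pending). [this work] [status: open] -/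
@[conjecture] def TLCGateConvTLB : Prop :=
  ∀ (y q : ℝ) (M₁ M₂ : ℕ) (μ₁ μ₂ : ℕ → ℝ),
    0 < y → y < 1 → 0 < q → q ≤ 1 →
    (∀ h, 0 ≤ μ₁ h) → (∀ h, M₁ < h → μ₁ h = 0) → (∑ h ∈ Finset.range (M₁ + 1), μ₁ h = 1) →
    y * (M₁ : ℝ) ≤ q * ∑ h ∈ Finset.range (M₁ + 1), (h : ℝ) * μ₁ h →
    (∀ h, 0 ≤ μ₂ h) → (∀ h, M₂ < h → μ₂ h = 0) → (∑ h ∈ Finset.range (M₂ + 1), μ₂ h = 1) →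
    y * (M₂ : ℝ) ≤ q * ∑ h ∈ Finset.range (M₂ + 1), (h : ℝ) * μ₂ h →
    TLB (y / (1 - y)) (q * ∑ h ∈ Finset.range (M₁ + 1), (h : ℝ) * μ₁ h) M₁ (gate μ₁ q) →
    TLC y (q * ∑ h ∈ Finset.range (M₁ + 1), (h : ℝ) * μ₁ h) M₁ (gate μ₁ q) →
    TLB (y / (1 - y)) (q * ∑ h ∈ Finset.range (M₂ + 1), (h : ℝ) * μ₂ h) M₂ (gate μ₂ q) →
    TLC y (q * ∑ h ∈ Finset.range (M₂ + 1), (h : ℝ) * μ₂ h) M₂ (gate μ₂ q) →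
    TLB (y / (1 - y)) (q * ((∑ h ∈ Finset.range (M₁ + 1), (h : ℝ) * μ₁ h) + ∑ h ∈ Finset.range (M₂ + 1), (h : ℝ) * μ₂ h))
      (M₁ + M₂) (gate (lconv M₁ M₂ μ₁ μ₂) q)

/-- **G₀ restricted to DEC factors** (the form the single-gate route consumes; census-2 g63's `gateConv_deepLows`): under `TLCGateConvTLB`, in the
binder of `LawDec.SingleGateConvClosed` the gated convolution satisfies every two-layer bound. [this work] -/
theorem tlb_gateConv_of_decAt_all (hG : TLCGateConvTLB) (y q : ℝ) (M₁ M₂ : ℕ) (μ₁ μ₂ : ℕ → ℝ)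
    (hy0 : 0 < y) (hy1 : y < 1) (hq0 : 0 < q) (hq1 : q ≤ 1)
    (h10 : ∀ h, 0 ≤ μ₁ h) (h1M : ∀ h, M₁ < h → μ₁ h = 0) (h11 : ∑ h ∈ Finset.range (M₁ + 1), μ₁ h = 1)
    (h1T : y * (M₁ : ℝ) ≤ q * ∑ h ∈ Finset.range (M₁ + 1), (h : ℝ) * μ₁ h)
    (h20 : ∀ h, 0 ≤ μ₂ h) (h2M : ∀ h, M₂ < h → μ₂ h = 0) (h21 : ∑ h ∈ Finset.range (M₂ + 1), μ₂ h = 1)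
    (h2T : y * (M₂ : ℝ) ≤ q * ∑ h ∈ Finset.range (M₂ + 1), (h : ℝ) * μ₂ h)
    (hdec1 : ∀ j, j < M₁ → DECAt y j M₁ (gate μ₁ q)) (hdec2 : ∀ j, j < M₂ → DECAt y j M₂ (gate μ₂ q)) :
    TLB (y / (1 - y)) (q * ((∑ h ∈ Finset.range (M₁ + 1), (h : ℝ) * μ₁ h) + ∑ h ∈ Finset.range (M₂ + 1), (h : ℝ) * μ₂ h))
      (M₁ + M₂) (gate (lconv M₁ M₂ μ₁ μ₂) q) :=
  hG y q M₁ M₂ μ₁ μ₂ hy0 hy1 hq0 hq1 h10 h1M h11 h1T h20 h2M h21 h2T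
    (tlb_gate_of_decAt_all hy0 hy1 hq0.le hq1 h10 h11 hdec1) (tlc_gate_of_decAt_all hy0 hy1 hdec1)
    (tlb_gate_of_decAt_all hy0 hy1 hq0.le hq1 h20 h21 hdec2) (tlc_gate_of_decAt_all hy0 hy1 hdec2)

end LawDec

end Quant

end Summit.CriticalPhenomena.PercolationContinuityZ3.Theorems
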